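import Summits.BirchSwinnertonDyer.BirchSwinnertonDyer.Theorems.Rank1ResidualX9Defs
import Literature.NumberTheory.EllipticCurves.Rank1Residual.MuLambdaCarriers
import HarnessLib
import HarnessLib.Audit

/-!
# Non-constancy mod `p` of Teichmüller-orbit sums of plus symbols on class X9 — the cell's
# analytic-lens candidates AN-1 / AN-1⁺, filed as OPEN obligation nodes (`@[conjecture] def`)

HONEST FRAMING (cell `bsd-f3-mu`, D-0131 (3) FRONTIER TIER, HOME `run/shared/lean/pub/bsd-f3-mu/`).
TYPER's filing of the analytic / modular-symbol lens's two refuter-cleared statements (2026-08-27): a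
pure CONJECTURE LEAF — only `@[conjecture] def`s, no theorem, nothing about any curve asserted, typed ≠
proved ≠ endorsed.  STATUS IN THE CELL (all seats agree, the planner included): AN-1 is a SUPPORT
CARRIER, a REFORMULATION of item 19630 `AnalyticMuZeroOnClassX9` in FINITE modular-symbol currency —
per pair `TeichOrbitNonConstantAt W p ⟺ MuAnZeroAt W p` on the `p`-integral locus by Mazur–Tate–Teitelbaum
(10.1)–(10.2) + symbol integrality (the cell's PAPER bridges AN-S1/AN-S2; AN-S2's Greenberg–Vatsal §3
integrality is NOT a tree fact, so the equivalence is not claimed in the kernel) — NOT a new crux and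
not a route candidate; it is filed so that `-data`'s finite certificates (AN-D3) and the refuters' probes
have a typed, decidable target.  Kernel glue (AN-1⁺ ⟹ AN-1; AN-1 + AN-S1 ⟹ 19630; 19630 + AN-S2 ⟹ AN-1,
with AN-S1/AN-S2 as explicit hypotheses) lives in the sibling `TeichOrbitNonConstancyEdges.lean`.

## Provenance (cell record)

* MEMO-an.md §3–§5 (planner `-an`, 2026-08-27T14:02Z; `HOME/an/Sketch.lean`, rc 0): the object
  `S_f(p,n,a) = Σ_{η^{p−1}=1} [ηa/pⁿ]⁺_f` (Literature `Rank1Residual.teichOrbitSum`, MuLambdaCarriers §4)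
  and the KEY IDENTITY «`μ(L_p(f,α)) > 0` ⟺ for every `n ≥ 1`, `a ↦ S_f(p,n,a) mod p` is constant on
  `(ℤ/pⁿ)^×`» (MTT (10.1)–(10.2), `α ≡ a_p`, `[·]⁺_f` `p`-integral); candidates **AN-1
  `TeichOrbitNonConstancyOnClassX9`**, **AN-1⁺ `TeichOrbitNonConstancyIrreducible`**; AN-2 (W-SPAN,
  rigidity of the homology-valued residual `L`-function) is prose + GP only and is NOT typed (ref1: file
  only after the data sweep AN-D1, and only typed).
* REF1-AUDIT.md §3.1.an (refuter `-ref1`, 14:05Z; HOME/ref1/AnAudit.lean rc 0, BC7 CLEAN): AN-1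
  **SURVIVES as CARRIER ≡ 19630 mod AN-S1/AN-S2** (typing faithful: Teichmüller filter, representative,
  `1 ≤ ‖·‖_p` ⟺ nonzero with `v_p ≤ 0`; KEY IDENTITY re-derived in both directions; the junk direction
  off the integral locus is real but every USE carries `Irr ∧ p ≥ 5` good); AN-1⁺ **SURVIVES** (scope
  node = Greenberg's conjecture, analytic half; ⟹ AN-1 kernel).
* REF2-LITMAP.md §3 (refuter `-ref2`, 14:04Z): AN-1 = **DUP-of-19630, criterion IN PRINT** [Chakravarthy
  2024, arXiv:2408.07826 p. 6 eqn (1), `ν`-form; MTT86 §I.10 = tree `msdMeasure`; Pollack–Weston 2011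
  Prop. 3.7]; the `α`-free telescoped form is the memo's one step; «endorse as typed decidable support
  carrier over `ratPlusSymbol`, not crux»; caution honoured in the carrier's docstring: `teichOrbitSum` and
  `padicLFunction f` share the period `Ω⁺_f` of `ratPlusSymbol f`.  AN-1⁺ = OPEN = Greenberg's
  `μ`-conjecture (irreducible) in finite currency [GreenbergLNM1716 Conj. 1.11 p. 64 + BCS (a)], open even
  for surjective image.
* BC5 witness (MEMO-an §5): every certified row of the census of record (`k6fin_unitcoeff_cert.tsv` sha16
  dde28b2c4045f536, 790/790 two-engine `μ_an = 0`) has a unit coefficient, hence (AN-S2, paper)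
  non-constancy at some level `pⁿ`, `n ≤ n(λ_an)`; the direct finite check (AN-D3: per row, `n = 2, 3`,
  number of distinct residues of `S̄(n,·)`) is requested from `-data`.  Cheapest falsifier: a certified row
  whose orbit sums are constant mod `p` at all levels `≤ n(λ_an) + 1` — would contradict AN-S2, not 19630.
* Why novel (planner's own grade, MEMO-an §6): «reformulation/variant of a printed criterion (delta =
  `α`-free constancy form + typed carrier + the Mazur–Rubin sentence; no new mechanism)».

References: [MazurTateTeitelbaum1986Invent] §I.10; [Chakravarthy2024] eqn. (1) p. 6; [PollackWeston2011]
Prop. 3.7; [GreenbergLNM1716] Conj. 1.11; [GreenbergVatsal2000] §3, Prop. (3.7); HOME MEMO-an.md,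
REF1-AUDIT.md §3.1.an, REF2-LITMAP.md §3, CANDIDATES.md §1 rows 4/4⁺.
-/

-- the summit and its single problem are both named `BirchSwinnertonDyer` (registry layout D-0017):
-- the X9 class predicate lives in `Summit.BirchSwinnertonDyer.BirchSwinnertonDyer.Rank1Residual`
set_option linter.dupNamespace false

noncomputable section

open scoped Classical

open WeierstrassCurve Literature.NumberTheory.EllipticCurves
  Summit.BirchSwinnertonDyer.BirchSwinnertonDyer.Rank1Residual
open Literature.NumberTheory.EllipticCurves.Rank1Residual (TeichOrbitNonConstantAt)

namespace Summit.BirchSwinnertonDyer.Rank1Residual.SmallImageMu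

/-- **AN-1 — Teichmüller-orbit non-constancy on class X9 (OPEN class-wide; SUPPORT CARRIER ≡ item 19630
modulo the paper bridges AN-S1/AN-S2; refuter-cleared 2026-08-27; nothing asserted).**  At every X9 pair
`(W, p)` (no CM, `p ≥ 5` good ordinary, `E[p]` irreducible and NOT surjective): for every newform `f` of
`W`, at some level `pⁿ` two Teichmüller-orbit sums `S_f(p,n,a)`, `S_f(p,n,a′)` (`a, a′` units) satisfy
`1 ≤ ‖S_f(p,n,a) − S_f(p,n,a′)‖_p` (`Rank1Residual.TeichOrbitNonConstantAt W p`).  Item 19630 in finite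
modular-symbol currency; decided per pair by exact modular symbols.  Verbatim `HOME/an/Sketch.lean`.
[cite: MazurTateTeitelbaum1986Invent, §I.10 (10.1)–(10.2) — the measure; criterion printed in `ν`-form: Chakravarthy2024 eqn. (1)]
[cite: GreenbergLNM1716, §1 Conj. 1.11 (p. 64) — implies it (analytic half, with BCS (a))] -/
@[conjecture] def TeichOrbitNonConstancyOnClassX9 : Prop :=
  ∀ (W : WeierstrassCurve ℚ) [W.IsElliptic] [W.IsGloballyMinimal] (p : ℕ) [Fact p.Prime],
    ClassX9 W p → TeichOrbitNonConstantAt W p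

/-- **AN-1⁺ — the natural scope of AN-1 (OPEN; nothing asserted):** every good ordinary `p ≥ 5` with
`E[p]` irreducible (ANY image, CM allowed) has `TeichOrbitNonConstantAt W p` — Greenberg's Conj. 1.11 on
its analytic side, in orbit-sum currency; contains AN-1 (edges file) and the CM-partner class of item
19234; open even on the surjective locus (ref2).  Verbatim `HOME/an/Sketch.lean`.
[cite: GreenbergLNM1716, §1 Conj. 1.11 (p. 64) — the conjecture it transcribes (analytic half)]
[cite: MazurTateTeitelbaum1986Invent, §I.10] -/
@[conjecture] def TeichOrbitNonConstancyIrreducible : Prop :=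
  ∀ (W : WeierstrassCurve ℚ) [W.IsElliptic] [W.IsGloballyMinimal] (p : ℕ) [Fact p.Prime],
    5 ≤ p → IsOrdinaryAt W p → W.HasIrreducibleModPGaloisRep p → TeichOrbitNonConstantAt W p

end Summit.BirchSwinnertonDyer.Rank1Residual.SmallImageMu

end
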